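import Summits.QuantumFields.YangMills.Theorems.BalabanUVNodesK2StubD4FlatSlope
import Literature.MathematicalPhysics.QuantumFieldTheory.Balaban1983to89.Node00.Record13SepCoPH

/-!
# Crux K2⁷ `EndpointGivenBR13SepCoPH` (stmt-QuantumFields-20543), LINE 2 `shift-cauchy-everyslope` — THE PRICE OF ITS «FLAT-CORNER GUARD» S0:
# `SlopePosOfD1Record13` ⟺ «NO ZERO-SLOPE ONE-LOOP DRIFT AT ANY ADMISSIBLE RECORD» (jets-free), and {stub 1, S0} ⟺ ONE existential stub
# «a (D1) datum of POSITIVE slope» ⟺ «the record's one-loop numbers drift with a slope d > 0» — so S0 is row (D1)'s strict (AF-0r) sign, not a guard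

Cell `pub-balaban`, BINDER row D4 OWNER lineage `b2b-balaban-beta-an4` (gen 151; β-FLOW TEAM (1); line: 20543 per director-ym D-0145 LINE-FIRST), a COUNT-NEUTRAL pricing
certificate for the planner of record (pub-ymgap plan g79, `[YMPLAN-G79-K2-LINE2-RULING]` 2026-08-27T23:43Z: K2⁷ SKELETON v2 = line 1 VERBATIM ∪ line 2 with stubs
`stub_slopePos13 : SlopePosOfD1Record13` (S0), `stub_n17AtRecord13`, `stub_anchor13`, `stub_cont13`, `stub_d1Residue13` shared) and for CRIT-2's price sheet
(`Cruxes/EndpointGivenBR13SepCoPH/TRIAGE-crit2-shift-cauchy-everyslope.md`, P3 «guard: S0 `0 < stepBal Nc Lc` — the flat-corner exposure of an4 g148»).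

THE POINT.  Line 2's composition `EndpointGivenBR13SepCoPH_of_shiftCauchy` (sketch `Cruxes/…/ShiftCauchyEverySlopeSketch.lean` :200) reads the slope sign ONLY for THE datum
that stub 1 produces (`hslope := h₀ F θ hP hθ Lc … Js Nc hβ h1`).  The ∀-form S0 («EVERY datum pinned on the record's one-loop numbers with its residue has `0 < stepBal Nc Lc`»)
is much more than that use, and it is NOT a structural guard: by the (D1) lane's free parametrisation of the jets (dag-n26-c's `BalabanUVNodesK2D1StubJetsFree`:
`exists_datum_of_oneLoopDrift_nonneg`, `residue_iff_d1Drift`) and cell pub-balaban-gaps' slope rigidity (`Gaps.D1Residue.oneLoopDrift_slope_unique`), at every θ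
  S0(θ) ⟺ «no `A` with `OneLoopDrift 0 A β⁰_θ`»   (§1 `slopePos_iff_noZeroDrift`),
i.e. S0 asserts, JETS-FREE, that the record's one-loop numbers `β⁰_θ = beta0OfMerged … θ.v₀` (a `limUnder` object of NODE 00) do NOT have partial sums within a bounded distance of 0 —
the STRICT half of asymptotic freedom of the one-loop sequence (row (D1) ∕ G-an2-4 ∕ N25 territory: for Bałaban's numbers it follows from `β⁰_{k+1} → (11N²∕12π²)·log L > 0`,
[Balaban1987RG1] (1.3) p. 260 with (2.12)–(2.13) p. 268 — an ESTIMATE about the record, instance 0∕1 in the tree), not something a (D4) payer or a «guard» discharges.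
THE FREE CUT (§2): given stub 1 at θ, S0(θ) ⟺ «SOME datum has positive slope» (`slopePos_iff_exists_posDatum_of_exists_datum`), and «∃ datum of positive slope» ⟺
«∃ d > 0, A, OneLoopDrift d A β⁰_θ» (`exists_posDatum_iff_posDrift`); hence at the level of the registered TEXTS (§3, N = 2, `Stage13HParams`, v1.7 `SepCoPH` provisos, spelled
VERBATIM — the skeleton and the sketch are not tree modules): `D1AtRecord13 ∧ SlopePosOfD1Record13 ⟺ D1AtRecord13Pos` (`d1Pos13_iff_d1_and_slopePos13`) where `D1AtRecord13Pos` is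
stub 1's text with `0 < stepBal Nc Lc ∧` inserted, ⟺ «∀ F θ hP, Admissible → ∃ d A, 0 < d ∧ OneLoopDrift d A β⁰_θ» (`d1Pos13_iff_posDrift`).  So line 2 may carry ONE (D1)-side stub
(`D1AtRecord13Pos`, implied by any genuine (D1) proof, which names its own `Nc ≠ 0` and `Lc ≥ 2`: `Gaps.D1PinnedNumeral.stepBal_pos_iff`) instead of {stub 1, S0} — same strength
(an equivalence, §3), one stub fewer, and the (AF-0r) sign booked where it lives (row (D1)), exactly as idea-7's own docstring says («asymptotic freedom's sign, row (D1)'s business»).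

WHAT IS HERE (0 `def`, 0 `sorry`, axioms ⊆ the standard trio; [folklore] three-line compositions over tree theorems, imported, not restated):
* §1 (any θ : `Stage13Params F N`) `slopePos_iff_noZeroDrift`.
* §2 `slopePos_iff_exists_posDatum_of_exists_datum`, `exists_posDatum_iff_posDrift`, `slopePos_of_exists_posDatum`.
* §3 (the TEXTS, N = 2, θ : `Stage13HParams F 2`, provisos `Provisos₁₃SepCoPH`, `Admissible`): `slopePos13_iff_noZeroDrift`, `d1Pos13_iff_d1_and_slopePos13`, `d1Pos13_iff_posDrift`,
  `slopePos13_of_d1Pos13`.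

HONEST FRAMING.  A PRICING ∕ EQUIVALENCE certificate about the typed objects; NOTHING of Bałaban's analysis is asserted; S0, stub 1, `D1AtRecord13Pos`, the drift statements are ALL
unproved at the record (both sides of every ⟺; instance 0∕1); NOT a proof of any registered stub; K2⁷ ∕ N25 ∕ N26 NOT discharged; (D4) NOT discharged (critical-path width 0 = NODE O;
D4 DISCHARGE NO DATE); counts unmoved; one finite four-torus programme at fixed ε per run — NOT the continuum limit, NOT ℝ⁴, NOT OS, NOT a mass gap, NOT Clay.  No `instance`, no
`notation`, no `axiom`.  Sources (context only): [I] = [Balaban1987RG1] CMP **109** (1987): Thm 2 p. 259 (first sentence), (1.3) p. 260, (1.20)–(1.22) p. 264, (2.12)–(2.14) p. 268.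
-/

noncomputable section

open scoped Matrix.Norms.L2Operator

namespace Summit.QuantumFields.YangMills.Theorems.BalabanUVNodesK2Line2SlopeGuardPrice

open Literature.MathematicalPhysics.QuantumFieldTheory.Balaban1983to89
open Literature.MathematicalPhysics.QuantumFieldTheory.Balaban1983to89.FlowStep
open Literature.MathematicalPhysics.QuantumFieldTheory.Balaban1983to89.T4Continuum (T4Family)
open Literature.MathematicalPhysics.QuantumFieldTheory.Balaban1983to89.Node00
open Literature.MathematicalPhysics.QuantumFieldTheory.Balaban1983to89.B12Beta (secondMoment)
open Literature.MathematicalPhysics.QuantumFieldTheory.Balaban1983to89.Beta.OneStepKernelFamily (TbalOf)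
open Literature.MathematicalPhysics.QuantumFieldTheory.Balaban1983to89.Beta.OneStepResolventKernel (JetData)
open Literature.MathematicalPhysics.QuantumFieldTheory.Balaban1983to89.Beta.Drift (OneLoopDrift)
open Summit.QuantumFields.BalabanUV.Gaps
open Summit.QuantumFields.BalabanUV.Gaps.D1Residue (Residue d1Drift_of_residue oneLoopDrift_slope_unique)
open Summit.QuantumFields.YangMills.Theorems.BalabanUVNodesK2D1StubJetsFree (exists_datum_of_oneLoopDrift_nonneg)
open Summit.QuantumFields.YangMills.Theorems.BalabanUVNodesN26SlopeOfRecord13 (stepBal_natCast_nonneg)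

/-! ## §1 S0 at one θ ⟺ no zero-slope one-loop drift of the record's `β⁰_θ` (jets-free) -/

section AtRecord

variable (F : T4Family) (N : ℕ) [NeZero N] (θ : Stage13Params F N)

/-- **S0(θ) ⟺ NO ZERO-SLOPE DRIFT.**  «Every datum `(Lc, Js, Nc)` whose pinned `(0,1)` step second moments ARE the record's one-loop numbers `β⁰_θ` and which carries
the (D1) residue has `0 < stepBal Nc Lc`» ⟺ «there is no `A` with `OneLoopDrift 0 A β⁰_θ`» (⇒: a zero-slope drift IS a datum of slope `stepBal Nc 2 = 0` by dag-n26-c's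
`exists_datum_of_oneLoopDrift_nonneg`, contradicting positivity through `oneLoopDrift_slope_unique`; ⇐: a datum's residue is a drift of `β⁰_θ` at slope `stepBal Nc Lc ≥ 0`,
and slope `0` is excluded).  Both sides are statements about NODE 00's `limUnder` numbers; neither is proved. [cite: Balaban1987RG1, (2.12)–(2.13) p.268 and (1.22) p.264] -/
theorem slopePos_iff_noZeroDrift :
    (letI := θ.instVβ₁; letI := θ.instVβ₂; letI := θ.instιβ
      ∀ (Lc : ℕ) (_ : NeZero Lc) (Js : ℕ → JetData 3 Lc) (Nc : ℝ),
        (∀ j, beta0OfMerged (betaMerged F (mergedTermFamilyMatT F N (TcanOfRecord F N) (chiFixed29 F N θ.ν θ.ε₂₉) θ.εbg) θ.ρ8 θ.bV) θ.v₀ j =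
            secondMoment (TbalOf Lc Js j) 0 1) →
        Residue Lc Js Nc 0 1 → 0 < B12Normalization.stepBal Nc Lc) ↔
    (letI := θ.instVβ₁; letI := θ.instVβ₂; letI := θ.instιβ
      ∀ A : ℝ, ¬ OneLoopDrift 0 A
        (beta0OfMerged (betaMerged F (mergedTermFamilyMatT F N (TcanOfRecord F N) (chiFixed29 F N θ.ν θ.ε₂₉) θ.εbg) θ.ρ8 θ.bV) θ.v₀)) := by
  letI := θ.instVβ₁; letI := θ.instVβ₂; letI := θ.instιβ
  constructor
  · intro h A hA
    obtain ⟨Lc, inst, Js, Nc, hβ, hres⟩ := exists_datum_of_oneLoopDrift_nonneg le_rfl hA 0 1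
    have hpos := h Lc inst Js Nc hβ hres
    obtain ⟨A', hA'⟩ := d1Drift_of_residue Js hres
    have e : (fun j => secondMoment (TbalOf Lc Js j) 0 1) =
        beta0OfMerged (betaMerged F (mergedTermFamilyMatT F N (TcanOfRecord F N) (chiFixed29 F N θ.ν θ.ε₂₉) θ.εbg) θ.ρ8 θ.bV) θ.v₀ :=
      funext fun j => (hβ j).symm
    rw [e] at hA'
    have h0 : B12Normalization.stepBal Nc Lc = 0 := oneLoopDrift_slope_unique hA' hA
    exact absurd h0 hpos.ne'
  · intro h Lc inst Js Nc hβ hres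
    obtain ⟨A', hA'⟩ := d1Drift_of_residue Js hres
    have e : (fun j => secondMoment (TbalOf Lc Js j) 0 1) =
        beta0OfMerged (betaMerged F (mergedTermFamilyMatT F N (TcanOfRecord F N) (chiFixed29 F N θ.ν θ.ε₂₉) θ.εbg) θ.ρ8 θ.bV) θ.v₀ :=
      funext fun j => (hβ j).symm
    rw [e] at hA'
    rcases (stepBal_natCast_nonneg Nc Lc).lt_or_eq with hpos | hzero
    · exact hpos
    · exact absurd (hzero ▸ hA') (h A')

/-! ## §2 Given stub 1 at θ: S0(θ) ⟺ SOME datum has positive slope ⟺ a drift of `β⁰_θ` with slope `d > 0` -/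

/-- **GIVEN A DATUM, S0(θ) ⟺ SOME DATUM HAS POSITIVE SLOPE** (⇒ trivial; ⇐: every datum's slope is THE drift slope of `β⁰_θ`, `oneLoopDrift_slope_unique`).
[cite: Balaban1987RG1, (2.12)–(2.13) p.268 and (1.22) p.264] -/
theorem slopePos_iff_exists_posDatum_of_exists_datum
    (h₁ : letI := θ.instVβ₁; letI := θ.instVβ₂; letI := θ.instιβ
      ∃ (Lc : ℕ) (_ : NeZero Lc) (Js : ℕ → JetData 3 Lc) (Nc : ℝ),
        (∀ j, beta0OfMerged (betaMerged F (mergedTermFamilyMatT F N (TcanOfRecord F N) (chiFixed29 F N θ.ν θ.ε₂₉) θ.εbg) θ.ρ8 θ.bV) θ.v₀ j =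
            secondMoment (TbalOf Lc Js j) 0 1) ∧
        Residue Lc Js Nc 0 1) :
    (letI := θ.instVβ₁; letI := θ.instVβ₂; letI := θ.instιβ
      ∀ (Lc : ℕ) (_ : NeZero Lc) (Js : ℕ → JetData 3 Lc) (Nc : ℝ),
        (∀ j, beta0OfMerged (betaMerged F (mergedTermFamilyMatT F N (TcanOfRecord F N) (chiFixed29 F N θ.ν θ.ε₂₉) θ.εbg) θ.ρ8 θ.bV) θ.v₀ j =
            secondMoment (TbalOf Lc Js j) 0 1) →
        Residue Lc Js Nc 0 1 → 0 < B12Normalization.stepBal Nc Lc) ↔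
    (letI := θ.instVβ₁; letI := θ.instVβ₂; letI := θ.instιβ
      ∃ (Lc : ℕ) (_ : NeZero Lc) (Js : ℕ → JetData 3 Lc) (Nc : ℝ),
        0 < B12Normalization.stepBal Nc Lc ∧
        (∀ j, beta0OfMerged (betaMerged F (mergedTermFamilyMatT F N (TcanOfRecord F N) (chiFixed29 F N θ.ν θ.ε₂₉) θ.εbg) θ.ρ8 θ.bV) θ.v₀ j =
            secondMoment (TbalOf Lc Js j) 0 1) ∧
        Residue Lc Js Nc 0 1) := by
  letI := θ.instVβ₁; letI := θ.instVβ₂; letI := θ.instιβ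
  constructor
  · intro h
    obtain ⟨Lc, inst, Js, Nc, hβ, hres⟩ := h₁
    exact ⟨Lc, inst, Js, Nc, h Lc inst Js Nc hβ hres, hβ, hres⟩
  · rintro ⟨Lc₀, inst₀, Js₀, Nc₀, hpos₀, hβ₀, hres₀⟩ Lc inst Js Nc hβ hres
    obtain ⟨A₀, hA₀⟩ := d1Drift_of_residue Js₀ hres₀
    obtain ⟨A, hA⟩ := d1Drift_of_residue Js hres
    have e₀ : (fun j => secondMoment (TbalOf Lc₀ Js₀ j) 0 1) =
        beta0OfMerged (betaMerged F (mergedTermFamilyMatT F N (TcanOfRecord F N) (chiFixed29 F N θ.ν θ.ε₂₉) θ.εbg) θ.ρ8 θ.bV) θ.v₀ :=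
      funext fun j => (hβ₀ j).symm
    have e : (fun j => secondMoment (TbalOf Lc Js j) 0 1) =
        beta0OfMerged (betaMerged F (mergedTermFamilyMatT F N (TcanOfRecord F N) (chiFixed29 F N θ.ν θ.ε₂₉) θ.εbg) θ.ρ8 θ.bV) θ.v₀ :=
      funext fun j => (hβ j).symm
    rw [e₀] at hA₀
    rw [e] at hA
    rw [oneLoopDrift_slope_unique hA hA₀]
    exact hpos₀

/-- **«SOME DATUM OF POSITIVE SLOPE» ⟺ «A DRIFT OF `β⁰_θ` WITH SLOPE `d > 0`»** (jets-free; ⇒ the residue IS a drift at slope `stepBal Nc Lc`; ⇐ dag-n26-c's witness datum of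
slope `d` plus `oneLoopDrift_slope_unique`).  For Bałaban's numbers `d = (11N²∕12π²)·log L` — the one-loop asymptotic-freedom slope (row (D1)); unproved at the record.
[cite: Balaban1987RG1, (1.3) p.260 and (2.12)–(2.13) p.268] -/
theorem exists_posDatum_iff_posDrift :
    (letI := θ.instVβ₁; letI := θ.instVβ₂; letI := θ.instιβ
      ∃ (Lc : ℕ) (_ : NeZero Lc) (Js : ℕ → JetData 3 Lc) (Nc : ℝ),
        0 < B12Normalization.stepBal Nc Lc ∧
        (∀ j, beta0OfMerged (betaMerged F (mergedTermFamilyMatT F N (TcanOfRecord F N) (chiFixed29 F N θ.ν θ.ε₂₉) θ.εbg) θ.ρ8 θ.bV) θ.v₀ j =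
            secondMoment (TbalOf Lc Js j) 0 1) ∧
        Residue Lc Js Nc 0 1) ↔
    (letI := θ.instVβ₁; letI := θ.instVβ₂; letI := θ.instιβ
      ∃ d A : ℝ, 0 < d ∧ OneLoopDrift d A
        (beta0OfMerged (betaMerged F (mergedTermFamilyMatT F N (TcanOfRecord F N) (chiFixed29 F N θ.ν θ.ε₂₉) θ.εbg) θ.ρ8 θ.bV) θ.v₀)) := by
  letI := θ.instVβ₁; letI := θ.instVβ₂; letI := θ.instιβ
  constructor
  · rintro ⟨Lc, inst, Js, Nc, hpos, hβ, hres⟩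
    obtain ⟨A, hA⟩ := d1Drift_of_residue Js hres
    have e : (fun j => secondMoment (TbalOf Lc Js j) 0 1) =
        beta0OfMerged (betaMerged F (mergedTermFamilyMatT F N (TcanOfRecord F N) (chiFixed29 F N θ.ν θ.ε₂₉) θ.εbg) θ.ρ8 θ.bV) θ.v₀ :=
      funext fun j => (hβ j).symm
    rw [e] at hA
    exact ⟨_, A, hpos, hA⟩
  · rintro ⟨d, A, hd, h⟩
    obtain ⟨Lc, inst, Js, Nc, hβ, hres⟩ := exists_datum_of_oneLoopDrift_nonneg hd.le h 0 1
    refine ⟨Lc, inst, Js, Nc, ?_, hβ, hres⟩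
    obtain ⟨A', hA'⟩ := d1Drift_of_residue Js hres
    have e : (fun j => secondMoment (TbalOf Lc Js j) 0 1) =
        beta0OfMerged (betaMerged F (mergedTermFamilyMatT F N (TcanOfRecord F N) (chiFixed29 F N θ.ν θ.ε₂₉) θ.εbg) θ.ρ8 θ.bV) θ.v₀ :=
      funext fun j => (hβ j).symm
    rw [e] at hA'
    rw [oneLoopDrift_slope_unique hA' h]
    exact hd

/-- USE FORM: a datum of positive slope gives S0(θ) outright (no separate stub 1 needed — it IS a datum). [cite: Balaban1987RG1, (2.12)–(2.13) p.268] -/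
theorem slopePos_of_exists_posDatum
    (h : letI := θ.instVβ₁; letI := θ.instVβ₂; letI := θ.instιβ
      ∃ (Lc : ℕ) (_ : NeZero Lc) (Js : ℕ → JetData 3 Lc) (Nc : ℝ),
        0 < B12Normalization.stepBal Nc Lc ∧
        (∀ j, beta0OfMerged (betaMerged F (mergedTermFamilyMatT F N (TcanOfRecord F N) (chiFixed29 F N θ.ν θ.ε₂₉) θ.εbg) θ.ρ8 θ.bV) θ.v₀ j =
            secondMoment (TbalOf Lc Js j) 0 1) ∧
        Residue Lc Js Nc 0 1) :
    letI := θ.instVβ₁; letI := θ.instVβ₂; letI := θ.instιβ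
    ∀ (Lc : ℕ) (_ : NeZero Lc) (Js : ℕ → JetData 3 Lc) (Nc : ℝ),
      (∀ j, beta0OfMerged (betaMerged F (mergedTermFamilyMatT F N (TcanOfRecord F N) (chiFixed29 F N θ.ν θ.ε₂₉) θ.εbg) θ.ρ8 θ.bV) θ.v₀ j =
          secondMoment (TbalOf Lc Js j) 0 1) →
      Residue Lc Js Nc 0 1 → 0 < B12Normalization.stepBal Nc Lc := by
  letI := θ.instVβ₁; letI := θ.instVβ₂; letI := θ.instιβ
  obtain ⟨Lc, inst, Js, Nc, hpos, hβ, hres⟩ := h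
  exact (slopePos_iff_exists_posDatum_of_exists_datum F N θ ⟨Lc, inst, Js, Nc, hβ, hres⟩).2 ⟨Lc, inst, Js, Nc, hpos, hβ, hres⟩

end AtRecord

/-! ## §3 The TEXTS (N = 2, θ : `Node00.Stage13HParams F 2`, v1.7 `SepCoPH` provisos + `Admissible`) — spelled VERBATIM from plan g73's registered `K2Skeleton13SepCoPH`
(`D1AtRecord13`) and idea-7's sketch `Cruxes/EndpointGivenBR13SepCoPH/ShiftCauchyEverySlopeSketch.lean` (`SlopePosOfD1Record13`, :159); neither is a tree module -/

section Texts

/-- **S0 (`SlopePosOfD1Record13`, VERBATIM) ⟺ «NO ZERO-SLOPE ONE-LOOP DRIFT AT ANY ADMISSIBLE RECORD»** — S0 is a jets-free assertion about NODE 00's one-loop numbers (the strict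
(AF-0r) sign of row (D1)), not a structural guard; the provisos ∕ admissibility are carried, unused, on both sides. [cite: Balaban1987RG1, (1.3) p.260 and (2.12)–(2.13) p.268] -/
theorem slopePos13_iff_noZeroDrift :
    (∀ (F : T4Family) (θ : Node00.Stage13HParams F 2) (hP : θ.Provisos₁₃SepCoPH F 2), θ.Admissible F 2 →
      letI := θ.instVβ₁; letI := θ.instVβ₂; letI := θ.instιβ
      ∀ (Lc : ℕ) (_ : NeZero Lc) (Js : ℕ → JetData 3 Lc) (Nc : ℝ),
        (∀ j, beta0OfMerged (betaMerged F (mergedTermFamilyMatT F 2 (TcanOfRecord F 2) (chiFixed29 F 2 θ.ν θ.ε₂₉) θ.εbg) θ.ρ8 θ.bV) θ.v₀ j =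
            B12Beta.secondMoment (TbalOf Lc Js j) 0 1) →
        D1Residue.Residue Lc Js Nc 0 1 → 0 < B12Normalization.stepBal Nc Lc) ↔
    (∀ (F : T4Family) (θ : Node00.Stage13HParams F 2) (_ : θ.Provisos₁₃SepCoPH F 2), θ.Admissible F 2 →
      letI := θ.instVβ₁; letI := θ.instVβ₂; letI := θ.instιβ
      ∀ A : ℝ, ¬ OneLoopDrift 0 A
        (beta0OfMerged (betaMerged F (mergedTermFamilyMatT F 2 (TcanOfRecord F 2) (chiFixed29 F 2 θ.ν θ.ε₂₉) θ.εbg) θ.ρ8 θ.bV) θ.v₀)) :=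
  ⟨fun h F θ hP hθ => (slopePos_iff_noZeroDrift F 2 θ.toStage13Params).1 (h F θ hP hθ),
   fun h F θ hP hθ => (slopePos_iff_noZeroDrift F 2 θ.toStage13Params).2 (h F θ hP hθ)⟩

/-- **THE FREE CUT: {stub 1 `D1AtRecord13`, S0 `SlopePosOfD1Record13`} ⟺ ONE STUB `D1AtRecord13Pos`** (stub 1's text with `0 < stepBal Nc Lc ∧` inserted: «at every admissible
record SOME datum of POSITIVE slope is pinned on the one-loop numbers with its residue») — an EQUIVALENCE of cuts (same strength; 5 line-2 stubs instead of 6), and the shape a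
genuine (D1) proof delivers anyway (it names its own `Nc ≠ 0`, `Lc ≥ 2`: `Gaps.D1PinnedNumeral.stepBal_pos_iff`). [cite: Balaban1987RG1, (1.3) p.260 and (2.12)–(2.13) p.268] -/
theorem d1Pos13_iff_d1_and_slopePos13 :
    (∀ (F : T4Family) (θ : Node00.Stage13HParams F 2) (hP : θ.Provisos₁₃SepCoPH F 2), θ.Admissible F 2 →
      letI := θ.instVβ₁; letI := θ.instVβ₂; letI := θ.instιβ
      ∃ (Lc : ℕ) (_ : NeZero Lc) (Js : ℕ → JetData 3 Lc) (Nc : ℝ),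
        0 < B12Normalization.stepBal Nc Lc ∧
        (∀ j, beta0OfMerged (betaMerged F (mergedTermFamilyMatT F 2 (TcanOfRecord F 2) (chiFixed29 F 2 θ.ν θ.ε₂₉) θ.εbg) θ.ρ8 θ.bV) θ.v₀ j =
            B12Beta.secondMoment (TbalOf Lc Js j) 0 1) ∧
        D1Residue.Residue Lc Js Nc 0 1) ↔
    ((∀ (F : T4Family) (θ : Node00.Stage13HParams F 2) (hP : θ.Provisos₁₃SepCoPH F 2), θ.Admissible F 2 →
        letI := θ.instVβ₁; letI := θ.instVβ₂; letI := θ.instιβ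
        ∃ (Lc : ℕ) (_ : NeZero Lc) (Js : ℕ → JetData 3 Lc) (Nc : ℝ),
          (∀ j, beta0OfMerged (betaMerged F (mergedTermFamilyMatT F 2 (TcanOfRecord F 2) (chiFixed29 F 2 θ.ν θ.ε₂₉) θ.εbg) θ.ρ8 θ.bV) θ.v₀ j =
              B12Beta.secondMoment (TbalOf Lc Js j) 0 1) ∧
          D1Residue.Residue Lc Js Nc 0 1) ∧
      (∀ (F : T4Family) (θ : Node00.Stage13HParams F 2) (hP : θ.Provisos₁₃SepCoPH F 2), θ.Admissible F 2 →
        letI := θ.instVβ₁; letI := θ.instVβ₂; letI := θ.instιβ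
        ∀ (Lc : ℕ) (_ : NeZero Lc) (Js : ℕ → JetData 3 Lc) (Nc : ℝ),
          (∀ j, beta0OfMerged (betaMerged F (mergedTermFamilyMatT F 2 (TcanOfRecord F 2) (chiFixed29 F 2 θ.ν θ.ε₂₉) θ.εbg) θ.ρ8 θ.bV) θ.v₀ j =
              B12Beta.secondMoment (TbalOf Lc Js j) 0 1) →
          D1Residue.Residue Lc Js Nc 0 1 → 0 < B12Normalization.stepBal Nc Lc)) := by
  constructor
  · intro h
    refine ⟨fun F θ hP hθ => ?_, fun F θ hP hθ => slopePos_of_exists_posDatum F 2 θ.toStage13Params (h F θ hP hθ)⟩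
    obtain ⟨Lc, inst, Js, Nc, -, hβ, hres⟩ := h F θ hP hθ
    exact ⟨Lc, inst, Js, Nc, hβ, hres⟩
  · rintro ⟨h₁, h₀⟩ F θ hP hθ
    exact (slopePos_iff_exists_posDatum_of_exists_datum F 2 θ.toStage13Params (h₁ F θ hP hθ)).1 (h₀ F θ hP hθ)

/-- **`D1AtRecord13Pos` ⟺ «THE RECORD's ONE-LOOP NUMBERS DRIFT WITH A POSITIVE SLOPE»** (jets-free; dag-n26-c's `d1AtRecord13Sep_iff_oneLoopDrift_nonneg` with `0 ≤ d` sharpened to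
`0 < d`): what line 2's (D1) side + its «guard» cost together is exactly strict one-loop asymptotic freedom in drift form at every admissible record — row (D1) ∕ N25 content, unproved.
[cite: Balaban1987RG1, (1.3) p.260 and (2.12)–(2.13) p.268] -/
theorem d1Pos13_iff_posDrift :
    (∀ (F : T4Family) (θ : Node00.Stage13HParams F 2) (hP : θ.Provisos₁₃SepCoPH F 2), θ.Admissible F 2 →
      letI := θ.instVβ₁; letI := θ.instVβ₂; letI := θ.instιβ
      ∃ (Lc : ℕ) (_ : NeZero Lc) (Js : ℕ → JetData 3 Lc) (Nc : ℝ),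
        0 < B12Normalization.stepBal Nc Lc ∧
        (∀ j, beta0OfMerged (betaMerged F (mergedTermFamilyMatT F 2 (TcanOfRecord F 2) (chiFixed29 F 2 θ.ν θ.ε₂₉) θ.εbg) θ.ρ8 θ.bV) θ.v₀ j =
            B12Beta.secondMoment (TbalOf Lc Js j) 0 1) ∧
        D1Residue.Residue Lc Js Nc 0 1) ↔
    (∀ (F : T4Family) (θ : Node00.Stage13HParams F 2) (_ : θ.Provisos₁₃SepCoPH F 2), θ.Admissible F 2 →
      letI := θ.instVβ₁; letI := θ.instVβ₂; letI := θ.instιβ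
      ∃ d A : ℝ, 0 < d ∧ OneLoopDrift d A
        (beta0OfMerged (betaMerged F (mergedTermFamilyMatT F 2 (TcanOfRecord F 2) (chiFixed29 F 2 θ.ν θ.ε₂₉) θ.εbg) θ.ρ8 θ.bV) θ.v₀)) :=
  ⟨fun h F θ hP hθ => (exists_posDatum_iff_posDrift F 2 θ.toStage13Params).1 (h F θ hP hθ),
   fun h F θ hP hθ => (exists_posDatum_iff_posDrift F 2 θ.toStage13Params).2 (h F θ hP hθ)⟩

/-- USE FORM for a v2 skeleton keeping S0 as displayed: `D1AtRecord13Pos ⟹ SlopePosOfD1Record13` (and trivially `⟹ D1AtRecord13`), so a (D1) prover who lands the positive-slope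
datum closes BOTH line-2 (D1)-side stubs by name. [cite: Balaban1987RG1, (2.12)–(2.13) p.268] -/
theorem slopePos13_of_d1Pos13
    (h : ∀ (F : T4Family) (θ : Node00.Stage13HParams F 2) (hP : θ.Provisos₁₃SepCoPH F 2), θ.Admissible F 2 →
      letI := θ.instVβ₁; letI := θ.instVβ₂; letI := θ.instιβ
      ∃ (Lc : ℕ) (_ : NeZero Lc) (Js : ℕ → JetData 3 Lc) (Nc : ℝ),
        0 < B12Normalization.stepBal Nc Lc ∧
        (∀ j, beta0OfMerged (betaMerged F (mergedTermFamilyMatT F 2 (TcanOfRecord F 2) (chiFixed29 F 2 θ.ν θ.ε₂₉) θ.εbg) θ.ρ8 θ.bV) θ.v₀ j =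
            B12Beta.secondMoment (TbalOf Lc Js j) 0 1) ∧
        D1Residue.Residue Lc Js Nc 0 1) :
    ∀ (F : T4Family) (θ : Node00.Stage13HParams F 2) (hP : θ.Provisos₁₃SepCoPH F 2), θ.Admissible F 2 →
      letI := θ.instVβ₁; letI := θ.instVβ₂; letI := θ.instιβ
      ∀ (Lc : ℕ) (_ : NeZero Lc) (Js : ℕ → JetData 3 Lc) (Nc : ℝ),
        (∀ j, beta0OfMerged (betaMerged F (mergedTermFamilyMatT F 2 (TcanOfRecord F 2) (chiFixed29 F 2 θ.ν θ.ε₂₉) θ.εbg) θ.ρ8 θ.bV) θ.v₀ j =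
            B12Beta.secondMoment (TbalOf Lc Js j) 0 1) →
        D1Residue.Residue Lc Js Nc 0 1 → 0 < B12Normalization.stepBal Nc Lc :=
  (d1Pos13_iff_d1_and_slopePos13.1 h).2

end Texts

end Summit.QuantumFields.YangMills.Theorems.BalabanUVNodesK2Line2SlopeGuardPrice

end
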